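import Mathlib.Logic.Encodable.Basic
import Mathlib.Tactic.DeriveEncodable
import Mathlib.Combinatorics.SimpleGraph.Basic
import Literature.ModelTheory.FiniteModelTheory.HFSets
import HarnessLib

/-!
# BGS programs (abstract state machines over `HF(A)`) with the counting function, on graphs

Topic `Literature/ModelTheory/FiniteModelTheory`; part of the CONSTRUCTION item
`defn-CPTCardProgram` (Choiceless Polynomial Time with counting). This file is the PROGRAMMING
LANGUAGE BGS of Blass–Gurevich–Shelah (1999, §4) with the cardinality function `Card`
(1999, §4.8; Blass–Gurevich–Shelah 2002, §2) over the input vocabulary of GRAPHS (one binary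
relation `E`), i.e. SYNTAX and ONE-STEP SEMANTICS; the polynomial bounds, acceptance and the
class CPT+Card are in `CPTCardProgram.lean`.

* SYNTAX (decidable, `Encodable`): `BGS.Term` / `BGS.Args` (mutual) — variables; the logic names
  `true`, `false`, `¬`, `∧`, `∨`, `=`; the set-theoretic names `∈`, `∅`, `Atoms`, `⋃`,
  `TheUnique`, `Pair` and `Card`; the input predicate `E`; dynamic function symbols `f ∈ ℕ`
  applied to argument lists; and COMPREHENSION terms `{t(v) : v ∈ r : g(v)}` (1999, §4.1, §4.4).
  `BGS.Rule` — `Skip`, updates `f(t̄) := t₀`, `if g then R₁ else R₂ endif`,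
  `do forall v ∈ r, R enddo` (1999, §4.5); free variables `FV`; a PROGRAM is a rule without
  free variables (`BGS.Program`, 1999, §4.7).
* SEMANTICS over an input graph `G` on atoms `Fin n` (1999, §4.2, §4.4, §4.6): objects are
  `HF (Fin n)` (`HFSets.lean`); a STATE is the interpretation of the dynamic symbols,
  `BGS.DynState n := ℕ → List (HF (Fin n)) → HF (Fin n)` (initially constant `∅ = 0`);
  `Term.eval`, the update set `Rule.den` ("`Den(R, A)`"), CONSISTENT update sets, firing
  (`fire`: an inconsistent action changes nothing), the one-step `Program.step` and the states
  `Program.stateAt G i` of the run; `Halt`/`Output` are the nullary dynamic symbols `0`/`1`.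

Renderings (each leaves the class of decided queries unchanged, see `CPTCardProgram.lean`):
terms are untyped — a guard or connective argument "holds" iff its value is `true = 1`, which
is BGS's convention that connectives are `0` off `{0,1}` (a Boolean TERM discipline is
recovered by `t ↦ (t = true)`); dynamic symbols are natural numbers used at any arity, a
LOCATION being a pair (symbol, argument list) (1999, §4.6); variables are natural numbers with
environments `ℕ → HF (Fin n)`, binders `compr`/`forallDo` updating the environment.

## References

* A. Blass, Y. Gurevich, S. Shelah, *Choiceless polynomial time*, Ann. Pure Appl. Logic 100
  (1999) 141–187 = arXiv:math/9705225, §4 (the computation model).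
* A. Blass, Y. Gurevich, S. Shelah, *On polynomial time computation over unordered structures*,
  J. Symbolic Logic 67 (2002) 1093–1125 = arXiv:math/0102059, §2 (BGS with `Card`).
* A. Dawar, D. Richerby, B. Rossman, *Choiceless polynomial time, counting and the
  Cai–Fürer–Immerman graphs*, Ann. Pure Appl. Logic 152 (2008), §2.
-/

noncomputable section

namespace Literature.ModelTheory.FiniteModelTheory

namespace BGS

/-! ### Syntax -/

mutual
/-- **BGS terms** over the graph vocabulary with counting: variables `var v`; `∅`; `Atoms`;
`⋃ t`; `TheUnique t`; `Pair(s, t)`; `Card t`; the predicates `s ∈ t`, `s = t`; the logic names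
`true`, `false`, `¬`, `∧`, `∨`; the input predicate `E(s, t)`; dynamic function symbols
`f(t₁, …, t_j)` (`dyn f args`); and comprehension `{t : v ∈ r : g}` (`compr v t r g`, binding
`v` in `t` and `g`). [Blass–Gurevich–Shelah 1999, §4.1 and §4.4; Blass–Gurevich–Shelah 2002, §2]
[cite: arXivmath9705225, §4.4] -/
inductive Term : Type
  /-- variable `v` -/
  | var (v : ℕ)
  /-- the constant `∅` (`= 0 = false`) -/
  | empty
  /-- the constant `Atoms` -/
  | atoms
  /-- `⋃ t` -/
  | sUnion (t : Term)
  /-- `TheUnique(t)` -/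
  | theUnique (t : Term)
  /-- `Pair(s, t) = {s, t}` -/
  | pair (s t : Term)
  /-- `Card(t)` (the counting function) -/
  | card (t : Term)
  /-- `s ∈ t` -/
  | mem (s t : Term)
  /-- `s = t` -/
  | eq (s t : Term)
  /-- `true` (`= 1 = {∅}`) -/
  | cTrue
  /-- `false` (`= 0 = ∅`) -/
  | cFalse
  /-- `¬ t` -/
  | not (t : Term)
  /-- `s ∧ t` -/
  | and (s t : Term)
  /-- `s ∨ t` -/
  | or (s t : Term)
  /-- the input (edge) predicate `E(s, t)` -/
  | edge (s t : Term)
  /-- dynamic function symbol `f` applied to the arguments `args` -/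
  | dyn (f : ℕ) (args : Args)
  /-- comprehension `{t : v ∈ r : g}` -/
  | compr (v : ℕ) (t r g : Term)
/-- Argument lists of BGS terms (mutual with `Term`). [Blass–Gurevich–Shelah 1999, §4.4]
[cite: arXivmath9705225, §4.4] -/
inductive Args : Type
  /-- no arguments -/
  | nil
  /-- `t, args` -/
  | cons (t : Term) (rest : Args)
end

deriving instance DecidableEq for Term, Args
deriving instance Encodable for Term, Args

/-- **BGS transition rules**: `Skip`; the update `f(args) := t`; the conditional
`if g then R₁ else R₂ endif`; and the parallel `do forall v ∈ r, R enddo` (binding `v` in `R`).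
[Blass–Gurevich–Shelah 1999, §4.5] [cite: arXivmath9705225, §4.5] -/
inductive Rule : Type
  /-- `Skip` -/
  | skip
  /-- `f(args) := t` -/
  | update (f : ℕ) (args : Args) (t : Term)
  /-- `if g then R₁ else R₂ endif` -/
  | cond (g : Term) (R₁ R₂ : Rule)
  /-- `do forall v ∈ r, R enddo` -/
  | forallDo (v : ℕ) (r : Term) (R : Rule)
  deriving DecidableEq, Encodable

mutual
/-- Free variables of a term (`compr v t r g` binds `v` in `t` and `g`, not in `r`).
[Blass–Gurevich–Shelah 1999, §4.4] [folklore] -/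
def Term.FV : Term → Finset ℕ
  | .var v => {v}
  | .empty => ∅
  | .atoms => ∅
  | .sUnion t => t.FV
  | .theUnique t => t.FV
  | .pair s t => s.FV ∪ t.FV
  | .card t => t.FV
  | .mem s t => s.FV ∪ t.FV
  | .eq s t => s.FV ∪ t.FV
  | .cTrue => ∅
  | .cFalse => ∅
  | .not t => t.FV
  | .and s t => s.FV ∪ t.FV
  | .or s t => s.FV ∪ t.FV
  | .edge s t => s.FV ∪ t.FV
  | .dyn _ args => args.FV
  | .compr v t r g => r.FV ∪ (t.FV ∪ g.FV).erase v
/-- Free variables of an argument list. [folklore] -/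
def Args.FV : Args → Finset ℕ
  | .nil => ∅
  | .cons t rest => t.FV ∪ rest.FV
end

/-- Free variables of a rule (`forallDo v r R` binds `v` in `R`, not in `r`).
[Blass–Gurevich–Shelah 1999, §4.5] [folklore] -/
def Rule.FV : Rule → Finset ℕ
  | .skip => ∅
  | .update _ args t => args.FV ∪ t.FV
  | .cond g R₁ R₂ => g.FV ∪ R₁.FV ∪ R₂.FV
  | .forallDo v r R => r.FV ∪ R.FV.erase v

/-- **A BGS program**: a rule without free variables. (Its vocabulary is the finite set of
dynamic symbols occurring in it; `Halt` and `Output` are the nullary symbols `haltSym = 0`,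
`outputSym = 1`.) [Blass–Gurevich–Shelah 1999, §4.7] [cite: arXivmath9705225, §4.7] -/
structure Program where
  /-- the rule fired at every step -/
  rule : Rule
  /-- it has no free variables -/
  closed : rule.FV = ∅
  deriving DecidableEq

/-- Programs are codes: `Program ≃ {R : Rule // R.FV = ∅}` is encodable (decidable syntax).
[Blass–Gurevich–Shelah 1999, §5.1 ("use PTime programs as sentences")] [folklore] -/
instance : Encodable Program :=
  Encodable.ofEquiv {R : Rule // R.FV = ∅}
    ⟨fun P => ⟨P.rule, P.closed⟩, fun R => ⟨R.1, R.2⟩, fun _ => rfl, fun _ => rfl⟩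

/-- The dynamic symbol `Halt` (nullary). [Blass–Gurevich–Shelah 1999, §4.1] [folklore] -/
def haltSym : ℕ := 0

/-- The dynamic symbol `Output` (nullary). [Blass–Gurevich–Shelah 1999, §4.1] [folklore] -/
def outputSym : ℕ := 1

/-- The term `Halt`. [folklore] -/
def Term.halt : Term := .dyn haltSym .nil

/-- The term `Output`. [folklore] -/
def Term.output : Term := .dyn outputSym .nil

/-- `do-in-parallel R₀, R₁ enddo`, BGS's abbreviation
`do forall v ∈ {0, 1}, if v = 0 then R₀ else R₁ endif enddo` (with bound variable `v`).
[Blass–Gurevich–Shelah 1999, §4.5] [cite: arXivmath9705225, §4.5] -/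
def Rule.par (v : ℕ) (R₀ R₁ : Rule) : Rule :=
  .forallDo v (.pair .cFalse .cTrue) (.cond (.eq (.var v) .cFalse) R₀ R₁)

/-! ### Semantics: objects, states, values of terms -/

/-- The OBJECTS of a computation on an input with `n` atoms: `HF (Fin n)`. [Blass–Gurevich–Shelah
1999, §4.2] [folklore] -/
abbrev Obj (n : ℕ) : Type := HF (Fin n)

/-- A STATE's dynamic part: the interpretation of every dynamic symbol at every argument list
(the static part — set theory and the input graph — is fixed). [Blass–Gurevich–Shelah 1999,
§4.2 (dynamic functions)] [folklore] -/
def DynState (n : ℕ) : Type := ℕ → List (Obj n) → Obj n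

/-- The INITIAL state: every dynamic function is constant `∅ = 0`. [Blass–Gurevich–Shelah 1999,
§4.3 ("initial if the extent of every dynamic function is empty"); 2002, §2] [folklore] -/
def DynState.init (n : ℕ) : DynState n := fun _ _ => ∅

/-- The value of `Halt` in a state. [folklore] -/
def DynState.halt {n : ℕ} (S : DynState n) : Obj n := S haltSym []

/-- The value of `Output` in a state. [folklore] -/
def DynState.output {n : ℕ} (S : DynState n) : Obj n := S outputSym []

/-- Variable ENVIRONMENTS (assignments; all but finitely many values are irrelevant).
[Blass–Gurevich–Shelah 1999, §4.6 (expanded states)] [folklore] -/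
abbrev Env (n : ℕ) : Type := ℕ → Obj n

open Classical in
/-- The predicate `x ∈ s` as an object (`1`/`0`). [Blass–Gurevich–Shelah 1999, §4.2] [folklore] -/
def memB {n : ℕ} (x s : Obj n) : Obj n := HF.ofBool (decide (x ∈ s))

/-- The predicate `x = y` as an object. [Blass–Gurevich–Shelah 1999, §4.2] [folklore] -/
def eqB {n : ℕ} (x y : Obj n) : Obj n := HF.ofBool (decide (x = y))

open Classical in
/-- The input predicate `E(x, y)` as an object: `1` iff `x`, `y` are adjacent ATOMS ("input
predicates live over the atoms"). [Blass–Gurevich–Shelah 1999, §4.2] [folklore] -/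
def edgeB {n : ℕ} (G : SimpleGraph (Fin n)) (x y : Obj n) : Obj n :=
  HF.ofBool (decide (∃ a b, x = HF.atom a ∧ y = HF.atom b ∧ G.Adj a b))

/-- `eqB x x = true`. [folklore] -/
@[simp] theorem eqB_self {n : ℕ} (x : Obj n) : eqB x x = HF.ofBool true := by simp [eqB]

/-- `eqB x y = false` for `x ≠ y`. [folklore] -/
theorem eqB_of_ne {n : ℕ} {x y : Obj n} (h : x ≠ y) : eqB x y = HF.ofBool false := by simp [eqB, h]

/-- `memB x s = true ↔ x ∈ s`. [folklore] -/
theorem memB_eq_true_iff {n : ℕ} {x s : Obj n} : memB x s = HF.ofBool true ↔ x ∈ s := by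
  classical
  simp [memB]

section Eval

variable {n : ℕ} (G : SimpleGraph (Fin n)) (S : DynState n)

mutual
/-- **The value of a term** in state `S` on input `G` under environment `σ`. Comprehension:
`{t : v ∈ r : g}` is the set of values of `t` at those members `a` of the value of `r` for
which `g` holds (has value `1`) with `v ↦ a`. [Blass–Gurevich–Shelah 1999, §4.2, §4.4, §4.8;
Blass–Gurevich–Shelah 2002, §2] [cite: arXivmath9705225, §4.4] -/
def Term.eval : Term → Env n → Obj n
  | .var v, σ => σ v
  | .empty, _ => ∅
  | .atoms, _ => HF.atoms
  | .sUnion t, σ => HF.sUnion (t.eval σ)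
  | .theUnique t, σ => HF.theUnique (t.eval σ)
  | .pair s t, σ => HF.pair (s.eval σ) (t.eval σ)
  | .card t, σ => HF.card (t.eval σ)
  | .mem s t, σ => memB (s.eval σ) (t.eval σ)
  | .eq s t, σ => eqB (s.eval σ) (t.eval σ)
  | .cTrue, _ => HF.ofBool true
  | .cFalse, _ => HF.ofBool false
  | .not t, σ => HF.bnot (t.eval σ)
  | .and s t, σ => HF.band (s.eval σ) (t.eval σ)
  | .or s t, σ => HF.bor (s.eval σ) (t.eval σ)
  | .edge s t, σ => edgeB G (s.eval σ) (t.eval σ)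
  | .dyn f args, σ => S f (args.eval σ)
  | .compr v t r g, σ =>
      HF.ofFinset ((((r.eval σ).members).filter fun a =>
        g.eval (Function.update σ v a) = HF.ofBool true).image fun a =>
          t.eval (Function.update σ v a))
/-- The values of an argument list. [folklore] -/
def Args.eval : Args → Env n → List (Obj n)
  | .nil, _ => []
  | .cons t rest, σ => t.eval σ :: rest.eval σ
end

/-- Membership in the value of a comprehension term. [Blass–Gurevich–Shelah 1999, §4.4]
[folklore] -/
theorem Term.mem_eval_compr {v : ℕ} {t r g : Term} {σ : Env n} {x : Obj n} :
    x ∈ (Term.compr v t r g).eval G S σ ↔ ∃ a ∈ r.eval G S σ,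
      g.eval G S (Function.update σ v a) = HF.ofBool true ∧
        t.eval G S (Function.update σ v a) = x := by
  rw [Term.eval, HF.mem_ofFinset, Finset.mem_image]
  simp only [Finset.mem_filter, HF.mem_members, and_assoc]

/-! ### Semantics: update sets, firing, runs -/

/-- An UPDATE `((f, ā), b)`: put `b` into the location `(f, ā)`. [Blass–Gurevich–Shelah 1999,
§4.6] [folklore] -/
abbrev Update (n : ℕ) : Type := (ℕ × List (Obj n)) × Obj n

/-- **The update set `Den(R, A)`** of a rule in state `S` under environment `σ`.
[Blass–Gurevich–Shelah 1999, §4.6] [cite: arXivmath9705225, §4.6] -/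
def Rule.den : Rule → Env n → Finset (Update n)
  | .skip, _ => ∅
  | .update f args t, σ => {((f, args.eval G S σ), t.eval G S σ)}
  | .cond g R₁ R₂, σ => if g.eval G S σ = HF.ofBool true then R₁.den σ else R₂.den σ
  | .forallDo v r R, σ => (r.eval G S σ).members.biUnion fun a => R.den (Function.update σ v a)

end Eval

variable {n : ℕ}

/-- An action (update set) is CONSISTENT if no two of its updates clash (same location,
different contents). [Blass–Gurevich–Shelah 1999, §4.6] [cite: arXivmath9705225, §4.6] -/
def Consistent (U : Finset (Update n)) : Prop :=
  ∀ u ∈ U, ∀ u' ∈ U, u.1 = u'.1 → u.2 = u'.2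

open Classical in
/-- **Performing an action**: if `U` is consistent, fire all its updates simultaneously;
otherwise do nothing. [Blass–Gurevich–Shelah 1999, §4.6] [cite: arXivmath9705225, §4.6] -/
def fire (S : DynState n) (U : Finset (Update n)) : DynState n :=
  if Consistent U then
    fun f args => if h : ∃ b, ((f, args), b) ∈ U then h.choose else S f args
  else S

/-- Firing a consistent action writes the new content into an updated location. [folklore] -/
theorem fire_apply_of_mem {S : DynState n} {U : Finset (Update n)} (hU : Consistent U)
    {f : ℕ} {args : List (Obj n)} {b : Obj n} (h : ((f, args), b) ∈ U) :
    fire S U f args = b := by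
  classical
  have hex : ∃ b, ((f, args), b) ∈ U := ⟨b, h⟩
  simp only [fire, if_pos hU, dif_pos hex]
  exact hU _ hex.choose_spec _ h rfl

/-- An inconsistent action changes nothing. [Blass–Gurevich–Shelah 1999, §4.6] [folklore] -/
theorem fire_of_not_consistent {S : DynState n} {U : Finset (Update n)} (hU : ¬ Consistent U) :
    fire S U = S := by
  classical
  simp [fire, hU]

/-- Firing leaves untouched locations unchanged. [folklore] -/
theorem fire_apply_of_forall_not_mem {S : DynState n} {U : Finset (Update n)}
    {f : ℕ} {args : List (Obj n)} (h : ∀ b, ((f, args), b) ∉ U) :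
    fire S U f args = S f args := by
  classical
  by_cases hU : Consistent U
  · have hex : ¬ ∃ b, ((f, args), b) ∈ U := not_exists.mpr h
    simp only [fire, if_pos hU, dif_neg hex]
  · rw [fire_of_not_consistent hU]

/-- **One step of a program**: fire `Den(Π, A)` (closed rule, any environment — we use the
constant-`∅` one). [Blass–Gurevich–Shelah 1999, §4.6–4.7] [cite: arXivmath9705225, §4.7] -/
def Program.step (P : Program) (G : SimpleGraph (Fin n)) (S : DynState n) : DynState n :=
  fire S (P.rule.den G S fun _ => ∅)

/-- **The states of the run** of `Π` on `G`: `A₀` is initial and `A_{i+1}` is the sequel of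
`A_i`. (BGS stop the run at the first state where `Halt` holds; `Program.HaltsAt` in
`CPTCardProgram.lean` reads off that stage, later states being irrelevant.)
[Blass–Gurevich–Shelah 1999, §4.7 (runs)] [cite: arXivmath9705225, §4.7] -/
def Program.stateAt (P : Program) (G : SimpleGraph (Fin n)) : ℕ → DynState n
  | 0 => DynState.init n
  | i + 1 => P.step G (P.stateAt G i)

/-- The run starts in the initial state. [folklore] -/
@[simp] theorem Program.stateAt_zero (P : Program) (G : SimpleGraph (Fin n)) :
    P.stateAt G 0 = DynState.init n := rfl

/-- The successor state is one step of the program. [folklore] -/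
theorem Program.stateAt_succ (P : Program) (G : SimpleGraph (Fin n)) (i : ℕ) :
    P.stateAt G (i + 1) = P.step G (P.stateAt G i) := rfl

/-- **`Π` halts at stage `l`** on `G`: `Halt` holds (`= true`) at `A_l` and at no earlier
state, so that `⟨A₀, …, A_l⟩` is THE run of `Π` on `G` and `l` its length.
[Blass–Gurevich–Shelah 1999, §4.7 (the run of `Π` on `I`; the length of a finite run)]
[cite: arXivmath9705225, §4.7] -/
def Program.HaltsAt (P : Program) (G : SimpleGraph (Fin n)) (l : ℕ) : Prop :=
  (∀ i < l, (P.stateAt G i).halt ≠ HF.ofBool true) ∧ (P.stateAt G l).halt = HF.ofBool true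

/-- The halting stage is unique. [folklore] -/
theorem Program.HaltsAt.unique {P : Program} {G : SimpleGraph (Fin n)} {l l' : ℕ}
    (h : P.HaltsAt G l) (h' : P.HaltsAt G l') : l = l' := by
  by_contra hne
  rcases Nat.lt_or_gt_of_ne hne with hlt | hlt
  · exact h'.1 l hlt h.2
  · exact h.1 l' hlt h'.2

/-! ### Critical and active objects -/

/-- **Critical objects** of a state: atoms, `0`, `1`, values of dynamic functions, and
components of locations where a dynamic function is not `∅`. [Blass–Gurevich–Shelah 1999, §5.1]
[cite: arXivmath9705225, §5.1] -/
def DynState.Critical (S : DynState n) (x : Obj n) : Prop :=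
  x.IsAtom ∨ x.IsBool ∨ (∃ f args, S f args = x) ∨ (∃ f args, S f args ≠ ∅ ∧ x ∈ args)

/-- **Active objects** of a state: the critical objects and the members of their transitive
closures. [Blass–Gurevich–Shelah 1999, §5.1] [cite: arXivmath9705225, §5.1] -/
def DynState.Active (S : DynState n) (x : Obj n) : Prop :=
  ∃ y, S.Critical y ∧ (x = y ∨ x ∈ y.tc)

/-- Critical objects are active. [folklore] -/
theorem DynState.Critical.active {S : DynState n} {x : Obj n} (h : S.Critical x) : S.Active x :=
  ⟨x, h, Or.inl rfl⟩

/-- The objects ACTIVE IN THE RUN up to stage `l`: active at some `A_i`, `i ≤ l`.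
[Blass–Gurevich–Shelah 1999, §5.1 ("active in `ρ` if it is so at some state of `ρ`")]
[cite: arXivmath9705225, §5.1] -/
def Program.activeSet (P : Program) (G : SimpleGraph (Fin n)) (l : ℕ) : Set (Obj n) :=
  {x | ∃ i ≤ l, (P.stateAt G i).Active x}

/-- Atoms are active in every run. [Blass–Gurevich–Shelah 1999, §5.3 ("atoms and 0, 1 exist
already in the initial state")] [folklore] -/
theorem Program.atom_mem_activeSet (P : Program) (G : SimpleGraph (Fin n)) (l : ℕ) (a : Fin n) :
    HF.atom a ∈ P.activeSet G l :=
  ⟨0, Nat.zero_le _, DynState.Critical.active (Or.inl (HF.isAtom_atom a))⟩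

/-- `0 = false` and `1 = true` are active in every run. [Blass–Gurevich–Shelah 1999, §5.3]
[folklore] -/
theorem Program.ofBool_mem_activeSet (P : Program) (G : SimpleGraph (Fin n)) (l : ℕ) (b : Bool) :
    HF.ofBool b ∈ P.activeSet G l :=
  ⟨0, Nat.zero_le _, DynState.Critical.active (Or.inr (Or.inl (HF.isBool_ofBool b)))⟩

end BGS

end Literature.ModelTheory.FiniteModelTheory
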